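import Summits.AtomisticToContinuum.FouriersLaw.Theorems.LocalOhmBVLocalOhmStubEquilibriumPackageAux4
import Summits.AtomisticToContinuum.FouriersLaw.Theorems.LocalOhmBVLocalOhmStubEquilibriumPackageAux2
import Summits.AtomisticToContinuum.FouriersLaw.Theorems.LocalOhmBVLocalOhmStubSoftExtractionAux2
import Summits.AtomisticToContinuum.FouriersLaw.Theorems.JunctionLocalitySuperadditiveResistanceStubBypassBoundAux2
import Summits.AtomisticToContinuum.FouriersLaw.Theorems.JunctionLocalityNonBallisticProfileUniformBound
import Literature.MathematicalPhysics.KineticTheory.ChainReflection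

/-!
# Window–energy covariance, helpers I: second moments, Cauchy–Schwarz, kinetic invisibility, reflection

Helper file for stub `stub_windowEnergyCovarianceWeak_of_termDecay` (T1) of the birth line of crux
`LocalOhmBV.LocalOhm` (item stmt-AtomisticToContinuum-12009). For the free finite-volume Gibbs state
`μ_{N,T} = gibbsMeasure N T` of `pinnedChain ω₂ lam β γ` and a window observable
`G = g ∘ boxRestrictAt a n ∘ embed N c` (finite sites `a + c, …, a + c + n` of the `N`-chain, `g` continuous of
polynomial growth) this file records the elementary facts used to bound `Cov_{μ_{N,T}}(G, H_N)` uniformly in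
`N` and in the window position:

* `abs_cov_le_of_sq_le` — the AM–GM form of Cauchy–Schwarz, `|Cov(f, u)| ≤ K(∫ f², ∫ u²)` on a probability space;
* `window_sq_le`, `abs_cov_window_le` — `N`-uniform second moments of window observables (from
  `pinnedChain_gibbsMeasure_window_sq_le`) and the resulting `N`-uniform bound on the covariance of two
  window observables; the one-site energies `p_t²/2`, `U(q_t)`, `V(q_{t+1} - q_t)` are window observables
  (`abs_cov_kinetic_le`, `abs_cov_U_le`, `abs_cov_V_le`);
* `cov_kinetic_eq_zero` — `Cov(G, p_j²/2) = 0` for a site `j` outside the window (Gaussian integration by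
  parts in `p_j`: `integral_mul_sq_sub_gibbsMeasure_eq_zero` and equipartition);
* `boxRestrictAt_embed_siteReflection`, `cov_U_siteReflection`, `cov_V_siteReflection` — under the site
  reflection `i ↦ N-1-i` (which preserves `μ_{N,T}`, `V` being even) the window observable becomes the window
  observable with reversed profile `g ∘ rev` on the reflected window, `U(q_t) ↦ U(q_{rev t})` and the bond
  `(t, t+1) ↦ (rev (t+1), rev t)`.

Folklore; no definitions.
-/

set_option autoImplicit false

noncomputable section

namespace Summit.AtomisticToContinuum.FouriersLaw.Theorems.LocalOhmBirth.WindowEnergyCovariance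

open MeasureTheory Filter Topology
open scoped BigOperators
open Literature.MathematicalPhysics.KineticTheory Literature.MathematicalPhysics.KineticTheory.HeatConduction
open Summit.AtomisticToContinuum.FouriersLaw.Theorems.WindowLimit (embed embed_apply_of abs_coord_le_norm)
open Summit.AtomisticToContinuum.FouriersLaw.Theorems.LocalOhmBirth.SoftExtraction
  (polyBound_comp_boxRestrictAt_embed continuous_comp_boxRestrictAt_embed)
open Summit.AtomisticToContinuum.FouriersLaw.Cruxes.SuperadditiveResistance.FloatingProbeBypassLaplacian
  (integral_mul_sq_sub_gibbsMeasure_eq_zero pinnedChain_integral_snd_sq)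
open Summit.AtomisticToContinuum.FouriersLaw.Theorems.NonBallistic (measurePreserving_siteReflection_gibbsMeasure)

/-! ### Cauchy–Schwarz in AM–GM form -/

/-- **Covariance bound from second moments** (probability space): if `∫ f² ≤ K₁` and `∫ u² ≤ K₂` then
`|∫ f u - (∫ f)(∫ u)| ≤ (K₁ + K₂)/2 + ((K₁ + 1)/2)((K₂ + 1)/2)` (`2|fu| ≤ f² + u²`, `2|f| ≤ f² + 1`). [folklore] -/
theorem abs_cov_le_of_sq_le {X : Type*} [MeasurableSpace X] {μ : Measure X} [IsProbabilityMeasure μ]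
    {f u : X → ℝ} (hf : AEStronglyMeasurable f μ) (hu : AEStronglyMeasurable u μ)
    (hf2 : Integrable (fun x => f x ^ 2) μ) (hu2 : Integrable (fun x => u x ^ 2) μ)
    {K₁ K₂ : ℝ} (h1 : ∫ x, f x ^ 2 ∂μ ≤ K₁) (h2 : ∫ x, u x ^ 2 ∂μ ≤ K₂) :
    |(∫ x, f x * u x ∂μ) - (∫ x, f x ∂μ) * (∫ x, u x ∂μ)| ≤
      (K₁ + K₂) / 2 + ((K₁ + 1) / 2) * ((K₂ + 1) / 2) := by
  have hF : MemLp f 2 μ := (memLp_two_iff_integrable_sq hf).2 hf2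
  have hU : MemLp u 2 μ := (memLp_two_iff_integrable_sq hu).2 hu2
  have hfu : Integrable (fun x => f x * u x) μ := hF.integrable_mul hU
  have hfI : Integrable f μ := hF.integrable one_le_two
  have huI : Integrable u μ := hU.integrable one_le_two
  have hK₁ : 0 ≤ K₁ := (integral_nonneg fun x => sq_nonneg _).trans h1
  have e1 : |∫ x, f x * u x ∂μ| ≤ (K₁ + K₂) / 2 := by
    calc |∫ x, f x * u x ∂μ| ≤ ∫ x, |f x * u x| ∂μ := abs_integral_le_integral_abs
      _ ≤ ∫ x, (f x ^ 2 + u x ^ 2) / 2 ∂μ :=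
          integral_mono hfu.abs ((hf2.add hu2).div_const 2) fun x => by
            show |f x * u x| ≤ (f x ^ 2 + u x ^ 2) / 2
            rw [abs_mul]
            nlinarith [sq_nonneg (|f x| - |u x|), sq_abs (f x), sq_abs (u x)]
      _ = ((∫ x, f x ^ 2 ∂μ) + ∫ x, u x ^ 2 ∂μ) / 2 := by rw [integral_div, integral_add hf2 hu2]
      _ ≤ (K₁ + K₂) / 2 := by linarith
  have e2 : ∀ {v : X → ℝ} {K : ℝ}, Integrable v μ → Integrable (fun x => v x ^ 2) μ →
      ∫ x, v x ^ 2 ∂μ ≤ K → |∫ x, v x ∂μ| ≤ (K + 1) / 2 := by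
    intro v K hvI hv2 hK
    calc |∫ x, v x ∂μ| ≤ ∫ x, |v x| ∂μ := abs_integral_le_integral_abs
      _ ≤ ∫ x, (v x ^ 2 + 1) / 2 ∂μ :=
          integral_mono hvI.abs ((hv2.add (integrable_const 1)).div_const 2) fun x => by
            show |v x| ≤ (v x ^ 2 + 1) / 2
            nlinarith [sq_nonneg (|v x| - 1), sq_abs (v x)]
      _ = ((∫ x, v x ^ 2 ∂μ) + 1) / 2 := by
          rw [integral_div, integral_add hv2 (integrable_const 1)]
          simp
      _ ≤ (K + 1) / 2 := by linarith
  calc |(∫ x, f x * u x ∂μ) - (∫ x, f x ∂μ) * (∫ x, u x ∂μ)|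
      ≤ |∫ x, f x * u x ∂μ| + |(∫ x, f x ∂μ) * (∫ x, u x ∂μ)| := abs_sub _ _
    _ = |∫ x, f x * u x ∂μ| + |∫ x, f x ∂μ| * |∫ x, u x ∂μ| := by rw [abs_mul]
    _ ≤ (K₁ + K₂) / 2 + ((K₁ + 1) / 2) * ((K₂ + 1) / 2) :=
        add_le_add e1 (mul_le_mul (e2 hfI hf2 h1) (e2 huI hu2 h2) (abs_nonneg _) (by linarith))

/-! ### Window coordinates -/

/-- The window `boxRestrictAt a n ∘ embed N c` reads the finite sites `(a + c) + j`. [folklore] -/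
theorem boxRestrictAt_embed_apply {N c : ℕ} {a : ℤ} {n : ℕ} (h0 : 0 ≤ a + c) (hN : a + c + n < N)
    (z : PhaseSpace N) (j : Fin (n + 1)) :
    boxRestrictAt a n (embed N c z) j =
      (z.1 ⟨(a + c).toNat + j.val, by omega⟩, z.2 ⟨(a + c).toNat + j.val, by omega⟩) := by
  have hj := j.isLt
  rw [boxRestrictAt_apply, embed_apply_of N c z (z := a + ((j : ℕ) : ℤ)) (by constructor <;> omega)]
  have h1 : (a + ((j : ℕ) : ℤ) + c).toNat = (a + c).toNat + j.val := by omega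
  exact Prod.ext (congrArg z.1 (Fin.ext h1)) (congrArg z.2 (Fin.ext h1))

/-- The window of size `k` anchored at the finite site `t` (centre `0`) reads the sites `t + j`. [folklore] -/
theorem boxRestrictAt_embed_site {N k : ℕ} (t : Fin N) (hk : t.val + k < N) (z : PhaseSpace N)
    (j : Fin (k + 1)) :
    boxRestrictAt ((t.val : ℕ) : ℤ) k (embed N 0 z) j =
      (z.1 ⟨t.val + j.val, by omega⟩, z.2 ⟨t.val + j.val, by omega⟩) := by
  rw [boxRestrictAt_embed_apply (a := ((t.val : ℕ) : ℤ)) (c := 0) (by push_cast; omega)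
    (by push_cast; omega) z j]
  have h1 : (((t.val : ℕ) : ℤ) + ((0 : ℕ) : ℤ)).toNat + j.val = t.val + j.val := by omega
  exact Prod.ext (congrArg z.1 (Fin.ext h1)) (congrArg z.2 (Fin.ext h1))

/-- The window anchored at `t` reads `(q_t, p_t)` at its first site. [folklore] -/
theorem boxRestrictAt_embed_site_zero {N k : ℕ} (t : Fin N) (hk : t.val + k < N) (z : PhaseSpace N) :
    boxRestrictAt ((t.val : ℕ) : ℤ) k (embed N 0 z) 0 = (z.1 t, z.2 t) := by
  rw [boxRestrictAt_embed_site t hk z 0]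
  rfl

/-- The window of size `1` anchored at `t` reads `(q_{t+1}, p_{t+1})` at its second site. [folklore] -/
theorem boxRestrictAt_embed_site_one {N : ℕ} (t t' : Fin N) (ht : t'.val = t.val + 1) (z : PhaseSpace N) :
    boxRestrictAt ((t.val : ℕ) : ℤ) 1 (embed N 0 z) 1 = (z.1 t', z.2 t') := by
  have hk : t.val + 1 < N := ht ▸ t'.isLt
  rw [boxRestrictAt_embed_site t hk z 1]
  have h1 : (⟨t.val + (1 : Fin (1 + 1)).val, by simp; omega⟩ : Fin N) = t' := Fin.ext (by simp [ht])
  rw [h1]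

/-- Under the site reflection the window observable becomes the window with reversed profile on the
reflected window: `(box_a ∘ embed_c)(R z) = (box_{N-1-(a+c)-n} ∘ embed_0)(z) ∘ rev`. [folklore] -/
theorem boxRestrictAt_embed_siteReflection {N c : ℕ} {a : ℤ} {n : ℕ} (h0 : 0 ≤ a + c) (hN : a + c + n < N)
    (z : PhaseSpace N) (i : Fin (n + 1)) :
    boxRestrictAt a n (embed N c (siteReflection N z)) i =
      boxRestrictAt ((N : ℤ) - 1 - (a + c) - n) n (embed N 0 z) (Fin.rev i) := by
  have hi := i.isLt
  rw [boxRestrictAt_embed_apply h0 hN, boxRestrictAt_embed_apply (c := 0) (by push_cast; omega)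
    (by push_cast; omega) z (Fin.rev i)]
  simp only [siteReflection_fst, siteReflection_snd]
  have h1 : Fin.rev (⟨(a + c).toNat + i.val, by omega⟩ : Fin N) =
      ⟨((N : ℤ) - 1 - (a + c) - n + ((0 : ℕ) : ℤ)).toNat + (Fin.rev i).val, by
        have := (Fin.rev i).isLt; push_cast; omega⟩ := by
    ext
    simp only [Fin.val_rev]
    omega
  rw [h1]

/-! ### `N`-uniform second moments of window observables; covariance of two window observables -/

section Pinned

variable {ω₂ lam β : ℝ}

/-- **`N`-uniform window second moments, `embed` form.** For continuous `g` of polynomial growth there is `K`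
with `∫ (g ∘ boxRestrictAt a n ∘ embed N c)² dμ_{N,T} ≤ K` for every `N` and every window inside the chain
(and the window observable and its square are integrable). [folklore] -/
theorem window_sq_le (γ : ℝ) (hω : 0 < ω₂) (hl : 0 ≤ lam) (hβ : 0 ≤ β) {T : ℝ} (hT : 0 < T) (n : ℕ)
    {g : (Fin (n + 1) → ℝ × ℝ) → ℝ} (hg : Continuous g) {C₀ : ℝ} {m : ℕ}
    (hle : ∀ y, |g y| ≤ C₀ * (1 + ‖y‖) ^ m) :
    ∃ K : ℝ, 0 ≤ K ∧ ∀ (N c : ℕ) (a : ℤ), 0 ≤ a + c → a + c + n < N →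
      Integrable (fun z : PhaseSpace N => g (boxRestrictAt a n (embed N c z)))
          ((pinnedChain ω₂ lam β γ).gibbsMeasure N T) ∧
        Integrable (fun z : PhaseSpace N => (g (boxRestrictAt a n (embed N c z))) ^ 2)
          ((pinnedChain ω₂ lam β γ).gibbsMeasure N T) ∧
        ∫ z, (g (boxRestrictAt a n (embed N c z))) ^ 2 ∂((pinnedChain ω₂ lam β γ).gibbsMeasure N T) ≤ K := by
  obtain ⟨K, hK0, hK⟩ := pinnedChain_gibbsMeasure_window_sq_le γ hω hl hβ hT n hg hle
  refine ⟨K, hK0, fun N c a h0 hN => ?_⟩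
  have hwin : ∀ z : PhaseSpace N, boxRestrictAt a n (embed N c z) = fun j : Fin (n + 1) =>
      (z.1 ⟨(a + c).toNat + j.val, by omega⟩, z.2 ⟨(a + c).toNat + j.val, by omega⟩) := fun z =>
    funext fun j => boxRestrictAt_embed_apply h0 hN z j
  obtain ⟨h1, h2, h3⟩ := hK N (a + c).toNat (by omega)
  simp only [hwin]
  exact ⟨h1, h2, h3⟩

/-- **`N`-uniform covariance bound for two window observables** of polynomial growth (Cauchy–Schwarz in
AM–GM form with the `N`-uniform window second moments). [folklore] -/
theorem abs_cov_window_le (γ : ℝ) (hω : 0 < ω₂) (hl : 0 ≤ lam) (hβ : 0 ≤ β) {T : ℝ} (hT : 0 < T)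
    (n₁ : ℕ) {g₁ : (Fin (n₁ + 1) → ℝ × ℝ) → ℝ} (hg₁ : Continuous g₁) {C₁ : ℝ} {m₁ : ℕ}
    (hb₁ : ∀ y, |g₁ y| ≤ C₁ * (1 + ‖y‖) ^ m₁)
    (n₂ : ℕ) {g₂ : (Fin (n₂ + 1) → ℝ × ℝ) → ℝ} (hg₂ : Continuous g₂) {C₂ : ℝ} {m₂ : ℕ}
    (hb₂ : ∀ y, |g₂ y| ≤ C₂ * (1 + ‖y‖) ^ m₂) :
    ∃ K : ℝ, 0 ≤ K ∧ ∀ (N c₁ : ℕ) (a₁ : ℤ) (c₂ : ℕ) (a₂ : ℤ), 0 ≤ a₁ + c₁ → a₁ + c₁ + n₁ < N →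
      0 ≤ a₂ + c₂ → a₂ + c₂ + n₂ < N →
      |(∫ z, g₁ (boxRestrictAt a₁ n₁ (embed N c₁ z)) * g₂ (boxRestrictAt a₂ n₂ (embed N c₂ z))
            ∂((pinnedChain ω₂ lam β γ).gibbsMeasure N T)) -
          (∫ z, g₁ (boxRestrictAt a₁ n₁ (embed N c₁ z)) ∂((pinnedChain ω₂ lam β γ).gibbsMeasure N T)) *
            (∫ z, g₂ (boxRestrictAt a₂ n₂ (embed N c₂ z)) ∂((pinnedChain ω₂ lam β γ).gibbsMeasure N T))| ≤
        K := by
  obtain ⟨K₁, hK₁, hK₁'⟩ := window_sq_le γ hω hl hβ hT n₁ hg₁ hb₁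
  obtain ⟨K₂, hK₂, hK₂'⟩ := window_sq_le γ hω hl hβ hT n₂ hg₂ hb₂
  refine ⟨(K₁ + K₂) / 2 + ((K₁ + 1) / 2) * ((K₂ + 1) / 2), by positivity,
    fun N c₁ a₁ c₂ a₂ h1 hN1 h2 hN2 => ?_⟩
  haveI : IsProbabilityMeasure ((pinnedChain ω₂ lam β γ).gibbsMeasure N T) :=
    pinnedChain_isProbabilityMeasure_gibbsMeasure hω hl hβ γ N hT
  obtain ⟨-, i1, e1⟩ := hK₁' N c₁ a₁ h1 hN1
  obtain ⟨-, i2, e2⟩ := hK₂' N c₂ a₂ h2 hN2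
  exact abs_cov_le_of_sq_le (continuous_comp_boxRestrictAt_embed a₁ n₁ hg₁).aestronglyMeasurable
    (continuous_comp_boxRestrictAt_embed a₂ n₂ hg₂).aestronglyMeasurable i1 i2 e1 e2

/-- The pinning energy profile `y ↦ U((y 0).1)` is continuous and of polynomial growth. [folklore] -/
theorem pinnedChain_U_profile (γ : ℝ) (hω : 0 ≤ ω₂) (hl : 0 ≤ lam) (k : ℕ) :
    Continuous (fun y : Fin (k + 1) → ℝ × ℝ => (pinnedChain ω₂ lam β γ).U ((y 0).1)) ∧
      ∀ y : Fin (k + 1) → ℝ × ℝ, |(pinnedChain ω₂ lam β γ).U ((y 0).1)| ≤ (ω₂ / 2 + lam / 4) * (1 + ‖y‖) ^ 4 := by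
  refine ⟨(pinnedChain_contDiff_U ω₂ lam β γ (n := 0)).continuous.comp
    (continuous_fst.comp (continuous_apply 0)), fun y => ?_⟩
  set s : ℝ := 1 + ‖y‖ with hs
  have hq : |(y 0).1| ≤ s := ((Real.norm_eq_abs _).symm.le.trans ((norm_fst_le (y 0)).trans
    (norm_le_pi_norm y 0))).trans (by rw [hs]; linarith [norm_nonneg y])
  have h1 : 1 ≤ s := by rw [hs]; linarith [norm_nonneg y]
  have q2 : (y 0).1 ^ 2 ≤ s ^ 2 := by rw [← sq_abs]; exact pow_le_pow_left₀ (abs_nonneg _) hq 2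
  have q4 : (y 0).1 ^ 4 ≤ s ^ 4 := by
    rw [← Even.pow_abs (by decide : Even 4)]; exact pow_le_pow_left₀ (abs_nonneg _) hq 4
  have s24 : s ^ 2 ≤ s ^ 4 := pow_le_pow_right₀ h1 (by norm_num)
  show |ω₂ * (y 0).1 ^ 2 / 2 + lam * (y 0).1 ^ 4 / 4| ≤ (ω₂ / 2 + lam / 4) * s ^ 4
  rw [abs_of_nonneg (by positivity)]
  nlinarith [mul_le_mul_of_nonneg_left (q2.trans s24) hω, mul_le_mul_of_nonneg_left q4 hl]

/-- The bond energy profile `y ↦ V((y 1).1 - (y 0).1)` is continuous and of polynomial growth. [folklore] -/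
theorem pinnedChain_V_profile (γ : ℝ) (hβ : 0 ≤ β) (ω₂ lam : ℝ) :
    Continuous (fun y : Fin (1 + 1) → ℝ × ℝ => (pinnedChain ω₂ lam β γ).V ((y 1).1 - (y 0).1)) ∧
      ∀ y : Fin (1 + 1) → ℝ × ℝ,
        |(pinnedChain ω₂ lam β γ).V ((y 1).1 - (y 0).1)| ≤ (2 + 4 * β) * (1 + ‖y‖) ^ 4 := by
  refine ⟨(pinnedChain_contDiff_V ω₂ lam β γ (n := 0)).continuous.comp
    ((continuous_fst.comp (continuous_apply 1)).sub (continuous_fst.comp (continuous_apply 0))),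
    fun y => ?_⟩
  set s : ℝ := 1 + ‖y‖ with hs
  have hc : ∀ i : Fin (1 + 1), |(y i).1| ≤ ‖y‖ := fun i =>
    (Real.norm_eq_abs _).symm.le.trans ((norm_fst_le (y i)).trans (norm_le_pi_norm y i))
  have hq : |(y 1).1 - (y 0).1| ≤ 2 * s := by
    have := abs_sub ((y 1).1) ((y 0).1)
    rw [hs]; linarith [hc 0, hc 1, norm_nonneg y]
  have h1 : 1 ≤ s := by rw [hs]; linarith [norm_nonneg y]
  have q2 : ((y 1).1 - (y 0).1) ^ 2 ≤ (2 * s) ^ 2 := by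
    rw [← sq_abs]; exact pow_le_pow_left₀ (abs_nonneg _) hq 2
  have q4 : ((y 1).1 - (y 0).1) ^ 4 ≤ (2 * s) ^ 4 := by
    rw [← Even.pow_abs (by decide : Even 4)]; exact pow_le_pow_left₀ (abs_nonneg _) hq 4
  have s24 : s ^ 2 ≤ s ^ 4 := pow_le_pow_right₀ h1 (by norm_num)
  show |((y 1).1 - (y 0).1) ^ 2 / 2 + β * ((y 1).1 - (y 0).1) ^ 4 / 4| ≤ (2 + 4 * β) * s ^ 4
  rw [abs_of_nonneg (by positivity)]
  nlinarith [mul_le_mul_of_nonneg_left q4 hβ]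

/-- The kinetic energy profile `y ↦ (y 0).2² / 2` is continuous and of polynomial growth. [folklore] -/
theorem kinetic_profile (k : ℕ) :
    Continuous (fun y : Fin (k + 1) → ℝ × ℝ => (y 0).2 ^ 2 / 2) ∧
      ∀ y : Fin (k + 1) → ℝ × ℝ, |(y 0).2 ^ 2 / 2| ≤ 1 * (1 + ‖y‖) ^ 2 := by
  refine ⟨((continuous_snd.comp (continuous_apply 0)).pow 2).div_const 2, fun y => ?_⟩
  have hq : |(y 0).2| ≤ 1 + ‖y‖ := ((Real.norm_eq_abs _).symm.le.trans ((norm_snd_le (y 0)).trans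
    (norm_le_pi_norm y 0))).trans (by linarith [norm_nonneg y])
  have q2 : (y 0).2 ^ 2 ≤ (1 + ‖y‖) ^ 2 := by rw [← sq_abs]; exact pow_le_pow_left₀ (abs_nonneg _) hq 2
  rw [abs_of_nonneg (by positivity)]
  nlinarith [sq_nonneg ((y 0).2)]

/-- **`|Cov_{μ_{N,T}}(G, p_t²/2)| ≤ K`** uniformly in `N`, the window position and the site `t`. [folklore] -/
theorem abs_cov_kinetic_le (γ : ℝ) (hω : 0 < ω₂) (hl : 0 ≤ lam) (hβ : 0 ≤ β) {T : ℝ} (hT : 0 < T) (n : ℕ)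
    {g : (Fin (n + 1) → ℝ × ℝ) → ℝ} (hg : Continuous g) {C₀ : ℝ} {m : ℕ}
    (hle : ∀ y, |g y| ≤ C₀ * (1 + ‖y‖) ^ m) :
    ∃ K : ℝ, 0 ≤ K ∧ ∀ (N c : ℕ) (a : ℤ), 0 ≤ a + c → a + c + n < N → ∀ t : Fin N,
      |(∫ z, g (boxRestrictAt a n (embed N c z)) * (z.2 t ^ 2 / 2) ∂((pinnedChain ω₂ lam β γ).gibbsMeasure N T)) -
          (∫ z, g (boxRestrictAt a n (embed N c z)) ∂((pinnedChain ω₂ lam β γ).gibbsMeasure N T)) *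
            (∫ z, z.2 t ^ 2 / 2 ∂((pinnedChain ω₂ lam β γ).gibbsMeasure N T))| ≤ K := by
  obtain ⟨hc, hb⟩ := kinetic_profile 0
  obtain ⟨K, hK0, hK⟩ := abs_cov_window_le γ hω hl hβ hT n hg hle 0 hc hb
  refine ⟨K, hK0, fun N c a h0 hN t => ?_⟩
  have h := hK N c a 0 ((t.val : ℕ) : ℤ) h0 hN (by push_cast; omega) (by push_cast; omega)
  simpa only [boxRestrictAt_embed_site_zero t (by omega : t.val + 0 < N)] using h

/-- **`|Cov_{μ_{N,T}}(G, U(q_t))| ≤ K`** uniformly in `N`, the window position and the site `t`. [folklore] -/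
theorem abs_cov_U_le (γ : ℝ) (hω : 0 < ω₂) (hl : 0 ≤ lam) (hβ : 0 ≤ β) {T : ℝ} (hT : 0 < T) (n : ℕ)
    {g : (Fin (n + 1) → ℝ × ℝ) → ℝ} (hg : Continuous g) {C₀ : ℝ} {m : ℕ}
    (hle : ∀ y, |g y| ≤ C₀ * (1 + ‖y‖) ^ m) :
    ∃ K : ℝ, 0 ≤ K ∧ ∀ (N c : ℕ) (a : ℤ), 0 ≤ a + c → a + c + n < N → ∀ t : Fin N,
      |(∫ z, g (boxRestrictAt a n (embed N c z)) * (pinnedChain ω₂ lam β γ).U (z.1 t)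
            ∂((pinnedChain ω₂ lam β γ).gibbsMeasure N T)) -
          (∫ z, g (boxRestrictAt a n (embed N c z)) ∂((pinnedChain ω₂ lam β γ).gibbsMeasure N T)) *
            (∫ z, (pinnedChain ω₂ lam β γ).U (z.1 t) ∂((pinnedChain ω₂ lam β γ).gibbsMeasure N T))| ≤ K := by
  obtain ⟨hc, hb⟩ := pinnedChain_U_profile (β := β) γ hω.le hl 0
  obtain ⟨K, hK0, hK⟩ := abs_cov_window_le γ hω hl hβ hT n hg hle 0 hc hb
  refine ⟨K, hK0, fun N c a h0 hN t => ?_⟩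
  have h := hK N c a 0 ((t.val : ℕ) : ℤ) h0 hN (by push_cast; omega) (by push_cast; omega)
  simpa only [boxRestrictAt_embed_site_zero t (by omega : t.val + 0 < N)] using h

/-- **`|Cov_{μ_{N,T}}(G, V(q_{t+1} - q_t))| ≤ K`** uniformly in `N`, the window position and the bond. [folklore] -/
theorem abs_cov_V_le (γ : ℝ) (hω : 0 < ω₂) (hl : 0 ≤ lam) (hβ : 0 ≤ β) {T : ℝ} (hT : 0 < T) (n : ℕ)
    {g : (Fin (n + 1) → ℝ × ℝ) → ℝ} (hg : Continuous g) {C₀ : ℝ} {m : ℕ}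
    (hle : ∀ y, |g y| ≤ C₀ * (1 + ‖y‖) ^ m) :
    ∃ K : ℝ, 0 ≤ K ∧ ∀ (N c : ℕ) (a : ℤ), 0 ≤ a + c → a + c + n < N → ∀ t t' : Fin N,
      t'.val = t.val + 1 →
      |(∫ z, g (boxRestrictAt a n (embed N c z)) * (pinnedChain ω₂ lam β γ).V (z.1 t' - z.1 t)
            ∂((pinnedChain ω₂ lam β γ).gibbsMeasure N T)) -
          (∫ z, g (boxRestrictAt a n (embed N c z)) ∂((pinnedChain ω₂ lam β γ).gibbsMeasure N T)) *
            (∫ z, (pinnedChain ω₂ lam β γ).V (z.1 t' - z.1 t) ∂((pinnedChain ω₂ lam β γ).gibbsMeasure N T))| ≤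
        K := by
  obtain ⟨hc, hb⟩ := pinnedChain_V_profile γ hβ ω₂ lam
  obtain ⟨K, hK0, hK⟩ := abs_cov_window_le γ hω hl hβ hT n hg hle 1 hc hb
  refine ⟨K, hK0, fun N c a h0 hN t t' ht => ?_⟩
  have hk : t.val + 1 < N := ht ▸ t'.isLt
  have h := hK N c a 0 ((t.val : ℕ) : ℤ) h0 hN (by push_cast; omega) (by push_cast; omega)
  simpa only [boxRestrictAt_embed_site_zero t hk, boxRestrictAt_embed_site_one t t' ht] using h

/-! ### Kinetic terms outside the window have zero covariance with the window observable -/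

/-- **Invisibility of far momenta**: for a site `j` outside the window, `Cov_{μ_{N,T}}(G, p_j²/2) = 0`
(`G` does not depend on `p_j`; Gaussian integration by parts `∫ G (p_j² - T) dμ_{N,T} = 0` and
equipartition `∫ p_j² dμ_{N,T} = T`). [folklore] -/
theorem cov_kinetic_eq_zero (γ : ℝ) (hω : 0 < ω₂) (hl : 0 ≤ lam) (hβ : 0 ≤ β) {T : ℝ} (hT : 0 < T)
    {n : ℕ} {g : (Fin (n + 1) → ℝ × ℝ) → ℝ} (hg : Continuous g) {C₀ : ℝ} {m : ℕ}
    (hle : ∀ y, |g y| ≤ C₀ * (1 + ‖y‖) ^ m) {N c : ℕ} {a : ℤ} (h0 : 0 ≤ a + c) (hN : a + c + n < N)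
    (j : Fin N) (hj : (j.val : ℤ) < a + c ∨ a + c + n < (j.val : ℤ)) :
    (∫ z, g (boxRestrictAt a n (embed N c z)) * (z.2 j ^ 2 / 2) ∂((pinnedChain ω₂ lam β γ).gibbsMeasure N T)) -
        (∫ z, g (boxRestrictAt a n (embed N c z)) ∂((pinnedChain ω₂ lam β γ).gibbsMeasure N T)) *
          (∫ z, z.2 j ^ 2 / 2 ∂((pinnedChain ω₂ lam β γ).gibbsMeasure N T)) = 0 := by
  set μ := (pinnedChain ω₂ lam β γ).gibbsMeasure N T with hμ
  set G : PhaseSpace N → ℝ := fun z => g (boxRestrictAt a n (embed N c z)) with hG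
  have hGc : Continuous G := continuous_comp_boxRestrictAt_embed a n hg
  have hGb : ∀ z, |G z| ≤ C₀ * (1 + ‖z‖) ^ m := fun z => polyBound_comp_boxRestrictAt_embed a n hle z
  obtain ⟨K, -, hK⟩ := window_sq_le γ hω hl hβ hT n hg hle
  obtain ⟨i0, i2, -⟩ := hK N c a h0 hN
  have hF2 : MemLp G 2 μ := (memLp_two_iff_integrable_sq hGc.aestronglyMeasurable).2 i2
  -- `G` does not depend on `p_j`
  have hF : ∀ (x : PhaseSpace N) (t : ℝ), G (x + t • ((0, Pi.single j 1) : PhaseSpace N)) = G x := by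
    intro x t
    show g (boxRestrictAt a n (embed N c (x + t • ((0, Pi.single j 1) : PhaseSpace N)))) =
      g (boxRestrictAt a n (embed N c x))
    refine congrArg g (funext fun i => ?_)
    have hi := i.isLt
    rw [boxRestrictAt_embed_apply h0 hN, boxRestrictAt_embed_apply h0 hN]
    have hne : (⟨(a + c).toNat + i.val, by omega⟩ : Fin N) ≠ j := fun h => by
      have h' := congrArg Fin.val h
      simp only at h'
      rcases hj with hj | hj <;> omega
    simp only [add_smul_unitP_fst, add_smul_unitP_snd, Pi.add_apply, Pi.smul_apply, Pi.single_apply,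
      if_neg hne, smul_zero, add_zero]
  have h0' := integral_mul_sq_sub_gibbsMeasure_eq_zero hω hl hβ γ N hT j hF hF2
  -- integrability of `G p_j²/2`
  have hp : ∀ z : PhaseSpace N, |z.2 j ^ 2 / 2| ≤ 1 * (1 + ‖z‖) ^ 2 := fun z => by
    have hq : |z.2 j| ≤ 1 + ‖z‖ := (abs_coord_le_norm z j).2.trans (by linarith [norm_nonneg z])
    have q2 : z.2 j ^ 2 ≤ (1 + ‖z‖) ^ 2 := by rw [← sq_abs]; exact pow_le_pow_left₀ (abs_nonneg _) hq 2
    rw [abs_of_nonneg (by positivity)]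
    nlinarith [sq_nonneg (z.2 j)]
  have i1 : Integrable (fun z => G z * (z.2 j ^ 2 / 2)) μ := by
    obtain ⟨C, k, h⟩ := polyBound_mul ⟨C₀, m, hGb⟩ ⟨1, 2, hp⟩
    exact integrable_gibbsMeasure_of_polyBound hω hl hβ γ N hT (hGc.mul (by fun_prop)) h
  have h1 : ∫ z, G z * (z.2 j ^ 2 - T) ∂μ = 2 * (∫ z, G z * (z.2 j ^ 2 / 2) ∂μ) - T * ∫ z, G z ∂μ := by
    rw [← integral_const_mul, ← integral_const_mul, ← integral_sub (i1.const_mul 2) (i0.const_mul T)]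
    refine integral_congr_ae (Eventually.of_forall fun z => ?_)
    simp only
    ring
  have h2 : ∫ z : PhaseSpace N, z.2 j ^ 2 / 2 ∂μ = T / 2 := by
    rw [integral_div, pinnedChain_integral_snd_sq hω hl hβ γ N hT j]
  have h3 : ∫ z, G z * (z.2 j ^ 2 - T) ∂μ = 0 := h0'
  rw [h1] at h3
  rw [h2]
  linear_combination h3 / 2

/-- **Registered sub-goal (helper I of T1 `stub_windowEnergyCovarianceWeak_of_termDecay`)**: under the finite-volume
Gibbs state of the pinned chain, the kinetic energy `p_j²/2` of a site `j` OUTSIDE the window has zero covariance with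
every continuous polynomially bounded window observable `g ∘ boxRestrictAt a n ∘ embed N c`. [folklore] -/
theorem windowEnergy_covKinetic_eq_zero :
    ∀ ω₂ lam β γ : ℝ, 0 < ω₂ → 0 ≤ lam → 0 ≤ β → ∀ T : ℝ, 0 < T →
    ∀ (n : ℕ) (g : (Fin (n + 1) → ℝ × ℝ) → ℝ), Continuous g →
    (∃ (C₀ : ℝ) (m : ℕ), ∀ y, |g y| ≤ C₀ * (1 + ‖y‖) ^ m) →
    ∀ (N c : ℕ) (a : ℤ), 0 ≤ a + c → a + c + n < N → ∀ j : Fin N,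
      ((j.val : ℤ) < a + c ∨ a + c + n < (j.val : ℤ)) →
      (∫ z, g (boxRestrictAt a n (embed N c z)) * (z.2 j ^ 2 / 2) ∂((pinnedChain ω₂ lam β γ).gibbsMeasure N T)) -
          (∫ z, g (boxRestrictAt a n (embed N c z)) ∂((pinnedChain ω₂ lam β γ).gibbsMeasure N T)) *
            (∫ z, z.2 j ^ 2 / 2 ∂((pinnedChain ω₂ lam β γ).gibbsMeasure N T)) = 0 :=
  fun _ω₂ _lam _β γ hω hl hβ _T hT _n _g hg hb _N _c _a h0 hN j hj => by
    obtain ⟨C₀, m, hle⟩ := hb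
    exact cov_kinetic_eq_zero γ hω hl hβ hT hg hle h0 hN j hj

end Pinned

end Summit.AtomisticToContinuum.FouriersLaw.Theorems.LocalOhmBirth.WindowEnergyCovariance

end
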